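import Summits.CriticalPhenomena.PercolationContinuityZ3.Theorems.PercNearOneGluingNoHeavyQuantTopFlippedLightHeavyCells
import Summits.CriticalPhenomena.PercolationContinuityZ3.Theorems.PercNearOneGluingNoHeavyQuantSingleLowCapacity
import Summits.CriticalPhenomena.PercolationContinuityZ3.Theorems.PercNearOneGluingNoHeavyQuantLightTwoBlobFlow
import Summits.CriticalPhenomena.PercolationContinuityZ3.Theorems.PercNearOneGluingNoHeavyQuantTwoBlobTopFlippedHeavy
import HarnessLib

/-!
# QUANT lane R8, T-DEC, binder (II) `ConvClosedTResidue`: the TOP-FLIPPED LIGHT–HEAVY PIECE is DEC at the sum of the ARCH credits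
# (part 3: the `DECAtT` statement — item P1-NEW of the lead's kernel plan for (II), FOR-PROVERS-CONV-PIECES §6 / README V286)

builds on p205010 (kernel theorem, internal audit signed; external expert review pending)

Support file (`--supports stmt-CriticalPhenomena-4575`), QUANT lane seat prim-quant-arm-2 (gen 31), rung R8 of
`run/shared/lean/prim/quant/LADDER.md`.  Theorems only, standard axioms, no sorries, no definitions.  Companion of arm-2 g28's
`…QuantTwoBlobTopFlippedHeavy` (the H–H piece, every layer, BLOB-DEC(2)); here one cell (the first) is LIGHT and BLOB-DEC(2) is not
available — the proof is typer g23's single-low criterion `LawDec.decAtT_singleLow_iff` (only the bottom atom of the piece is low) plus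
the cell certificates of parts 1–2.

THE PIECE.  `LAW2[A, γ; B, g]` = law of `A·Bern(γ) + B·Bern(g)` (atoms `0, A, B, A+B`, masses `(1−γ)(1−g), γ(1−g), (1−γ)g, γg`),
`x² < γ < x` LIGHT (credit rate `κ = (γ − x²)/(1 − x)`), `x ≤ g ≤ 1` HEAVY, target = the sum of the two ARCH credits
`c = A·κ + B·g`, layer `j` with the cross atoms mids (`A, B ≤ j`, `c ≤ 2A`, `c ≤ 2B`) and the top a giant (`j + 1 ≤ A + B`) — the shape
`LMMG` of the (II) certificate — and the ASPECT HYPOTHESIS: the light cell is at most 4 times as long as the heavy one (`A ≤ 4B`; a LONG heavy partner never hurts).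
* **`LawDec.twoBlob_topFlipped_lightHeavy_decAtT`** — `DECAtT x c j (A + B) LAW2[A, γ; B, g]`.
* `LawDec.twoBlobShift_topFlipped_lightHeavy_decAtT` — shifted by `s`, any top `M ≥ s + A + B`, any target `T′ ≤ 2s + c`.
* `LawDec.lightHeavyPairPiece_decAtT` / `lconv_lightHeavyPairs_decAtT` / `shift_lightHeavyPairs_decAtT` — the piece in cell
  coordinates `{lo₁, hi₁; γ} ∗ {lo₂, hi₂; g}`, as `LawDec.lconv`, and in the `SH`-mixture form of `lconv_TP`.
* `LawDec.topFlipped_capacity_LH` — the real inequality behind it (capacity form, raised gates as `max(P′, x² + (1−x)P′)`).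
EXACT FINDINGS (seat folder `work/tfp`, lead g26's corner run on the shifted `LAW2`, stdlib fractions): the top-flipped piece with a
light cell is standalone DEC in 0 / 143 000 instances with aspect ratio ≤ 4 (sizes ≤ 48, all gate types) and FAILS from aspect ≈ 4.85
(x = 0.245, heavy credit x, light credit 0.59x; not 5.7 — the 1/40 grid of N66 missed it); the bound is ONE-SIDED (only a long LIGHT cell
hurts: light–heavy with heavy/light span ratio in [1/4, ∞) has 0 failures) and disappears for floors `x ≥ 3/10` (exact threshold
`(1−x)³ = 4x²`, x ≈ 0.2955, from the extreme configuration P′ = 1); the `LMLG` shapes (a LOW cross cell) are NOT standalone even at aspect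
≤ 4 unless the long cell is heavy.  Inside the kernel proof the aspect hypothesis is USED only in the cells with a light raised pair
(`LH_LH`, `LH_L1`) — the linter-visible `_hasp`/`_hr*` binders of the other cells record that they hold at every aspect ratio.

[this work]; DEC rules ARCH-TREES-G49 §2.2 / DEC-TAMP-G50 §3.1, the single-low criterion `…QuantSingleLowCapacity` (typer g23), the
cell-certificate pipeline FOR-PROVERS-CERT-PIPELINE (typer g23), the (II) piece anatomy FOR-PROVERS-CONV-PIECES (lead g26) — this lane.
Nothing here is cited as a published result.  The gluing rows served [cite: KozmaNitzan2024, Conjecture 3 (p. 15)]; product measure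
[cite: Grimmett1999, §1.3 p. 10].
-/

noncomputable section

namespace Summit.CriticalPhenomena.PercolationContinuityZ3.Theorems

namespace Quant

open Finset

/-- the two-point law `{lo, hi; g}` (as in `…QuantLawDEC`) -/
local notation3 "TP[" lo ", " hi ", " g ", " h "]" =>
  (g : ℝ) * (if (h : ℕ) = (hi : ℕ) then (1 : ℝ) else 0) + (1 - (g : ℝ)) * (if (h : ℕ) = (lo : ℕ) then (1 : ℝ) else 0)

/-- the law `μ` shifted up by `s` (as in `…QuantConvHeavy`) -/
local notation3 "SH[" μ ", " s ", " h "]" => (if (s : ℕ) ≤ (h : ℕ) then (μ : ℕ → ℝ) ((h : ℕ) - (s : ℕ)) else (0 : ℝ))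

/-- the two-blob law `(1−u)(1−v)δ₀ + u(1−v)δ_a + (1−u)vδ_b + uvδ_{a+b}` evaluated at `h` (as in `…QuantBlobDecTwoLawParts`) -/
local notation3 "LAW2[" a ", " u ", " b ", " v ", " h "]" =>
  (1 - (u : ℝ)) * (1 - (v : ℝ)) * (if (h : ℕ) = 0 then (1 : ℝ) else 0)
    + (u : ℝ) * (1 - (v : ℝ)) * (if (h : ℕ) = (a : ℕ) then (1 : ℝ) else 0)
    + (1 - (u : ℝ)) * (v : ℝ) * (if (h : ℕ) = (b : ℕ) then (1 : ℝ) else 0)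
    + (u : ℝ) * (v : ℝ) * (if (h : ℕ) = (a : ℕ) + (b : ℕ) then (1 : ℝ) else 0)

namespace LawDec

/-! ### The real inequality (capacity form) -/

/-- CORE (L⊗H): capacity inequality of the top-flipped light–heavy piece. -/
theorem topFlipped_capacity_LH (x p q P' Q' : ℝ) (hx0 : 0 < x) (hx1 : x < 1) (hp0 : 0 < p) (hpx : p < x)
    (hxq : x ≤ q) (hq1 : q ≤ 1) (hP : p < P') (hrel : (P' - p) * (Q' - q) = p * q) (hasp : q ≤ 4 * (P' - p))
    (hP2 : P' ≤ 2) (hQ2 : Q' ≤ 2) :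
    x / (1 - x) * ((1 - (x ^ 2 + (1 - x) * p)) * (1 - q)) ≤
      (if P' < 1 then x / (1 - x) * ((1 - max P' (x ^ 2 + (1 - x) * P')) / max P' (x ^ 2 + (1 - x) * P')) else 0)
          * ((x ^ 2 + (1 - x) * p) * (1 - q))
        + (if Q' < 1 then x / (1 - x) * ((1 - max Q' (x ^ 2 + (1 - x) * Q')) / max Q' (x ^ 2 + (1 - x) * Q')) else 0)
          * ((1 - (x ^ 2 + (1 - x) * p)) * q)
        + (x ^ 2 + (1 - x) * p) * q := by
  have h1x : 0 < 1 - x := by linarith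
  have hPp : 0 < P' - p := by linarith
  have hq0 : 0 < q := by linarith
  have hQ' : Q' = q * P' / (P' - p) := by
    rw [eq_div_iff hPp.ne']; linear_combination hrel
  have hQd : Q' - q = p * q / (P' - p) := by
    rw [eq_div_iff hPp.ne']; linear_combination hrel
  have hQq : q < Q' := by
    have : 0 < p * q / (P' - p) := div_pos (mul_pos hp0 hq0) hPp
    linarith
  have hxQ : x ≤ Q' := by linarith
  have hmaxQ : max Q' (x ^ 2 + (1 - x) * Q') = Q' := max_eq_left (by nlinarith)
  rw [hmaxQ]
  by_cases hP1 : P' < 1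
  · rw [if_pos hP1]
    by_cases hQ1 : Q' < 1
    · rw [if_pos hQ1]
      have hQ1' : q * P' < P' - p := by rw [hQ', div_lt_one hPp] at hQ1; exact hQ1
      have hQ2' : q * P' ≤ 2 * (P' - p) := by rw [hQ', div_le_iff₀ hPp] at hQ2; linarith
      rcases le_or_gt P' x with hPx | hxP
      · rw [max_eq_right (by nlinarith : P' ≤ x ^ 2 + (1 - x) * P'), hQ']
        exact tfpCell_LH_LH x p q P' hx0 hx1 hp0 hpx hxq hq1 hP hasp hPx hQ1' hP2 hQ2'
      · rw [max_eq_left (by nlinarith : x ^ 2 + (1 - x) * P' ≤ P'), hQ']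
        exact tfpCell_LH_HH x p q P' hx0 hx1 hp0 hpx hxq hq1 hP hasp hxP.le hP1 hQ1' hP2 hQ2'
    · rw [if_neg hQ1]
      have h1Q' : P' - p ≤ q * P' := by
        push Not at hQ1; rw [hQ', le_div_iff₀ hPp] at hQ1; linarith
      have hQ2' : q * P' ≤ 2 * (P' - p) := by rw [hQ', div_le_iff₀ hPp] at hQ2; linarith
      rcases le_or_gt P' x with hPx | hxP
      · rw [max_eq_right (by nlinarith : P' ≤ x ^ 2 + (1 - x) * P')]
        exact tfpCell_LH_L1 x p q P' hx0 hx1 hp0 hpx hxq hq1 hP hasp hPx h1Q' hP2 hQ2'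
      · rw [max_eq_left (by nlinarith : x ^ 2 + (1 - x) * P' ≤ P')]
        exact tfpCell_LH_H1 x p q P' hx0 hx1 hp0 hpx hxq hq1 hP hasp hxP.le hP1 h1Q' hP2 hQ2'
  · rw [if_neg hP1]
    push Not at hP1
    have hPp1 : 1 - p ≤ P' - p := by linarith
    have h1p : 0 < 1 - p := by linarith
    have hPge1 : Q' * (1 - p) ≤ q := by
      have h1 : p * q / (P' - p) ≤ p * q / (1 - p) :=
        div_le_div_of_nonneg_left (mul_pos hp0 hq0).le h1p hPp1
      have h2 : Q' - q ≤ p * q / (1 - p) := by rw [hQd]; exact h1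
      have h3 : (Q' - q) * (1 - p) ≤ p * q := by rw [le_div_iff₀ h1p] at h2; exact h2
      linarith
    have hasp' : Q' - q ≤ 4 * p := by
      have hq4 : 0 < q / 4 := by linarith
      have h1 : p * q / (P' - p) ≤ p * q / (q / 4) :=
        div_le_div_of_nonneg_left (mul_pos hp0 hq0).le hq4 (by linarith)
      rw [hQd]
      calc p * q / (P' - p) ≤ p * q / (q / 4) := h1
        _ = 4 * p := by field_simp
    by_cases hQ1 : Q' < 1
    · rw [if_pos hQ1]
      exact tfpCell_LH_1H x p q Q' hx0 hx1 hp0 hpx hxq hq1 hQq hPge1 hasp' hxQ hQ1 hQ2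
    · rw [if_neg hQ1]
      push Not at hQ1
      exact tfpCell_LH_11 x p q Q' hx0 hx1 hp0 hpx hxq hq1 hQq hPge1 hasp' hQ1 hQ2


/-! ### Assembly -/

/-- `Σ_{h ≤ M} f h · (c·[h = k]) = f k · c` for `k ≤ M`. -/
theorem sum_range_mul_const_indicator (M k : ℕ) (hk : k ≤ M) (f : ℕ → ℝ) (c : ℝ) :
    ∑ h ∈ Finset.range (M + 1), f h * (c * (if h = k then (1 : ℝ) else 0)) = f k * c := by
  rw [Finset.sum_eq_single k]
  · rw [if_pos rfl, mul_one]
  · intro h _ hne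
    rw [if_neg hne, mul_zero, mul_zero]
  · intro hk'
    exact absurd (Finset.mem_range.2 (Nat.lt_succ_of_le hk)) hk'
/-- capCoef of a compatible mid for the low atom `0`, in closed form: `(x/(1−x))·(1 − γ)/γ`, `γ = max(c/h, x² + (1−x)c/h)`. -/
theorem capCoef_zero_mid (x c : ℝ) (j h : ℕ) (hx0 : 0 < x) (hx1 : x < 1) (hhj : h ≤ j) (hc0 : 0 < c)
    (hc2 : c ≤ 2 * (h : ℝ)) (hch : c < (h : ℝ)) :
    capCoef x c j 0 h = x / (1 - x) * ((1 - max (c / h) (x ^ 2 + (1 - x) * (c / h))) / max (c / h) (x ^ 2 + (1 - x) * (c / h))) := by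
  have hnotg : ¬ (j + 1 ≤ h) := by omega
  unfold capCoef
  rw [if_neg hnotg, if_pos ⟨hc2, by simpa using hch⟩]
  simp only [usage, gateOf, if_neg hnotg, pairGate]
  have e : (c - 2 * ((0 : ℕ) : ℝ)) / ((h : ℝ) - ((0 : ℕ) : ℝ)) = c / h := by simp
  rw [e]
  set γ : ℝ := max (c / h) (x ^ 2 + (1 - x) * (c / h)) with hγ
  have hγ0 : 0 < γ := lt_of_lt_of_le (div_pos hc0 (by exact_mod_cast (show 0 < h by exact_mod_cast (lt_of_le_of_lt (le_refl _) (by exact_mod_cast (show (0:ℝ) < h by linarith)))))) (le_max_left _ _)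
  have hγ1 : γ < 1 := by
    have h1 : c / h < 1 := by rw [div_lt_one (by linarith)]; exact hch
    refine max_lt h1 ?_
    nlinarith
  field_simp
/-- capCoef of an incompatible mid (`c ≥ h`, not a giant) for the low atom `0` is `0`. -/
theorem capCoef_zero_mid_incompat (x c : ℝ) (j h : ℕ) (hhj : h ≤ j) (hch : (h : ℝ) ≤ c) : capCoef x c j 0 h = 0 := by
  have hnotg : ¬ (j + 1 ≤ h) := by omega
  unfold capCoef
  rw [if_neg hnotg, if_neg]
  rintro ⟨_, h2⟩
  simp at h2
  linarith
/-- capCoef of a giant is `1`. -/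
theorem capCoef_giant (x c : ℝ) (j l h : ℕ) (hh : j + 1 ≤ h) : capCoef x c j l h = 1 := by
  unfold capCoef; rw [if_pos hh]
/-- capCoef of the low itself (`2·0 < c`, not a giant) is `0`. -/
theorem capCoef_zero_self (x c : ℝ) (j : ℕ) (hc0 : 0 < c) : capCoef x c j 0 0 = 0 := by
  unfold capCoef
  rw [if_neg (by omega), if_neg]
  rintro ⟨h1, _⟩
  simp at h1
  linarith
/-- **THE TOP-FLIPPED LIGHT–HEAVY PIECE.** -/
theorem twoBlob_topFlipped_lightHeavy_decAtT (x γ g : ℝ) (A B j : ℕ) (hx0 : 0 < x) (hx1 : x < 1)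
    (hγ0 : x ^ 2 < γ) (hγx : γ < x) (hxg : x ≤ g) (hg1 : g ≤ 1) (hA : 1 ≤ A) (hB : 1 ≤ B) (hAB : A ≤ 4 * B)
    (hAj : A ≤ j) (hBj : B ≤ j) (hj : j + 1 ≤ A + B)
    (hcA : (A : ℝ) * ((γ - x ^ 2) / (1 - x)) + (B : ℝ) * g ≤ 2 * (A : ℝ))
    (hcB : (A : ℝ) * ((γ - x ^ 2) / (1 - x)) + (B : ℝ) * g ≤ 2 * (B : ℝ)) :
    DECAtT x ((A : ℝ) * ((γ - x ^ 2) / (1 - x)) + (B : ℝ) * g) j (A + B) (fun h => LAW2[A, γ, B, g, h]) := by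
  classical
  have h1x : 0 < 1 - x := by linarith
  set p : ℝ := (γ - x ^ 2) / (1 - x) with hp
  have hp0 : 0 < p := div_pos (by linarith) h1x
  have hpx : p < x := by rw [hp, div_lt_iff₀ h1x]; nlinarith
  have hγp : γ = x ^ 2 + (1 - x) * p := by rw [hp]; field_simp; ring
  set c : ℝ := (A : ℝ) * p + (B : ℝ) * g with hc
  have hA0 : (0 : ℝ) < A := by exact_mod_cast hA
  have hB0 : (0 : ℝ) < B := by exact_mod_cast hB
  have hg0 : 0 < g := lt_of_lt_of_le hx0 hxg
  have hc0 : 0 < c := by rw [hc]; positivity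
  have hγ0' : 0 ≤ γ := by nlinarith
  have hγ1 : γ ≤ 1 := by linarith
  -- the single-low criterion
  have hν0 : ∀ k, 0 ≤ LAW2[A, γ, B, g, k] := fun k => BlobDec2.law_nonneg A B γ g hγ0' hγ1 hg0.le hg1 k
  have hνM : ∀ k, A + B < k → LAW2[A, γ, B, g, k] = 0 := fun k hk => BlobDec2.law_eq_zero_of_lt A B γ g k hk
  have hν1 : ∑ h ∈ Finset.range (A + B + 1), LAW2[A, γ, B, g, h] = 1 := BlobDec2.law_mass A B γ g
  have hsingle : ∀ k, k ≤ j → 2 * (k : ℝ) < c → k ≠ 0 → LAW2[A, γ, B, g, k] = 0 := by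
    intro k hkj hk hk0
    have hkA : k ≠ A := by rintro rfl; linarith
    have hkB : k ≠ B := by rintro rfl; linarith
    have hkAB : k ≠ A + B := by omega
    simp [hk0, hkA, hkB, hkAB]
  rw [(decAtT_singleLow_iff x c j (A + B) 0 _ hx0 hx1 hν0 hνM hν1 (Nat.zero_le _) (by simpa using hc0) hsingle)]
  -- evaluate both sides
  have hA0n : A ≠ 0 := by omega
  have hB0n : B ≠ 0 := by omega
  have hAB0 : A + B ≠ 0 := by omega
  have lhs : LAW2[A, γ, B, g, 0] = (1 - γ) * (1 - g) := by
    simp [hA0n.symm, hB0n.symm, hAB0.symm]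
  rw [lhs]
  have rhs : ∑ h ∈ Finset.range (A + B + 1), capCoef x c j 0 h * LAW2[A, γ, B, g, h]
      = capCoef x c j 0 A * (γ * (1 - g)) + capCoef x c j 0 B * ((1 - γ) * g) + γ * g := by
    simp_rw [mul_add, Finset.sum_add_distrib]
    rw [sum_range_mul_const_indicator _ 0 (Nat.zero_le _), sum_range_mul_const_indicator _ A (by omega),
      sum_range_mul_const_indicator _ B (by omega), sum_range_mul_const_indicator _ (A + B) le_rfl,
      capCoef_zero_self x c j hc0, capCoef_giant x c j 0 (A + B) hj]
    ring
  rw [rhs]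
  -- the two mid coefficients in closed form
  have hPrel : (c / A - p) * (c / B - g) = p * g := by
    rw [hc]; field_simp; ring
  have key := topFlipped_capacity_LH x p g (c / A) (c / B) hx0 hx1 hp0 hpx hxg hg1
    (by rw [hc, lt_div_iff₀ hA0]; nlinarith) hPrel
    (by
      have h4 : (A : ℝ) ≤ 4 * B := by exact_mod_cast hAB
      have e : c / A - p = B * g / A := by rw [hc]; field_simp; ring
      rw [e, show 4 * ((B : ℝ) * g / A) = (4 * B * g) / A by ring, le_div_iff₀ hA0]
      nlinarith [mul_le_mul_of_nonneg_left h4 hg0.le])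
    (by rw [div_le_iff₀ hA0]; linarith) (by rw [div_le_iff₀ hB0]; linarith)
  have eA : capCoef x c j 0 A = (if c / A < 1 then x / (1 - x) * ((1 - max (c / A) (x ^ 2 + (1 - x) * (c / A))) / max (c / A) (x ^ 2 + (1 - x) * (c / A))) else 0) := by
    split_ifs with hlt
    · exact capCoef_zero_mid x c j A hx0 hx1 hAj hc0 (by linarith) (by rwa [div_lt_one hA0] at hlt)
    · exact capCoef_zero_mid_incompat x c j A hAj (by push Not at hlt; rwa [one_le_div hA0] at hlt)
  have eB : capCoef x c j 0 B = (if c / B < 1 then x / (1 - x) * ((1 - max (c / B) (x ^ 2 + (1 - x) * (c / B))) / max (c / B) (x ^ 2 + (1 - x) * (c / B))) else 0) := by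
    split_ifs with hlt
    · exact capCoef_zero_mid x c j B hx0 hx1 hBj hc0 (by linarith) (by rwa [div_lt_one hB0] at hlt)
    · exact capCoef_zero_mid_incompat x c j B hBj (by push Not at hlt; rwa [one_le_div hB0] at hlt)
  rw [eA, eB, hγp]
  exact key

/-! ### The same piece shifted, in cell coordinates, as a convolution -/

/-- **THE TOP-FLIPPED LIGHTHEAVY PIECE, SHIFTED**: shift `s`, any top `M ≥ s + A + B`, any target `T′ ≤ 2s + c`; cross atoms mids
(`s + A, s + B ≤ j`, `c ≤ 2A`, `c ≤ 2B`), top a giant (`j + 1 ≤ s + A + B`). [this work] -/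
theorem twoBlobShift_topFlipped_lightHeavy_decAtT (x γ g T' : ℝ) (s A B j M : ℕ) (hx0 : 0 < x) (hx1 : x < 1)
    (hγ0 : x ^ 2 < γ) (hγx : γ < x) (hxg : x ≤ g) (hg1 : g ≤ 1) (hA : 1 ≤ A) (hB : 1 ≤ B) (hAB : A ≤ 4 * B)
    (hAj : s + A ≤ j) (hBj : s + B ≤ j) (hj : j + 1 ≤ s + A + B) (hM : s + A + B ≤ M)
    (hcA : (A : ℝ) * ((γ - x ^ 2) / (1 - x)) + (B : ℝ) * g ≤ 2 * (A : ℝ)) (hcB : (A : ℝ) * ((γ - x ^ 2) / (1 - x)) + (B : ℝ) * g ≤ 2 * (B : ℝ))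
    (hT' : T' ≤ 2 * (s : ℝ) + ((A : ℝ) * ((γ - x ^ 2) / (1 - x)) + (B : ℝ) * g)) :
    DECAtT x T' j M (fun h => if s ≤ h then LAW2[A, γ, B, g, h - s] else 0) := by
  classical
  have hdec := twoBlob_topFlipped_lightHeavy_decAtT x γ g A B (j - s) hx0 hx1 hγ0 hγx hxg hg1 hA hB hAB
    (by omega) (by omega) (by omega) hcA hcB
  have hsh := decAtT_shift_two x _ (j - s) (A + B) s _ hdec
  rw [show j - s + s = j by omega] at hsh
  exact decAtT_antitone_target (by linarith) (decAtT_mono_top hsh (by omega))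

/-- **THE TOP-FLIPPED LIGHTHEAVY PIECE in cell coordinates**: cells `{lo₁, hi₁; γ}` and `{lo₂, hi₂; g}` (`lo_i < hi_i`), the four-atom
piece `(1−γ)(1−g)δ_{lo₁+lo₂} + γ(1−g)δ_{hi₁+lo₂} + (1−γ)gδ_{lo₁+hi₂} + γgδ_{hi₁+hi₂}` is `DECAtT x T′ j′ M` for every `M ≥ hi₁ + hi₂` and every
`T′ ≤` the sum of the two (N)-credits, at a layer where the cross atoms are mids and the top atom is a giant. [this work] -/
theorem lightHeavyPairPiece_decAtT (x T' γ g : ℝ) (j' M lo₁ hi₁ lo₂ hi₂ : ℕ) (hx0 : 0 < x) (hx1 : x < 1)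
    (hxγ : x ^ 2 < γ) (hγx : γ < x) (hxg : x ≤ g) (hg1 : g ≤ 1) (h₁ : lo₁ < hi₁) (h₂ : lo₂ < hi₂) (hasp : hi₁ - lo₁ ≤ 4 * (hi₂ - lo₂))
    (hM : hi₁ + hi₂ ≤ M) (hj1 : hi₁ + lo₂ ≤ j') (hj2 : lo₁ + hi₂ ≤ j') (hj : j' + 1 ≤ hi₁ + hi₂)
    (hcA : ((hi₁ : ℝ) - lo₁) * ((γ - x ^ 2) / (1 - x)) + ((hi₂ : ℝ) - lo₂) * g ≤ 2 * ((hi₁ : ℝ) - lo₁))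
    (hcB : ((hi₁ : ℝ) - lo₁) * ((γ - x ^ 2) / (1 - x)) + ((hi₂ : ℝ) - lo₂) * g ≤ 2 * ((hi₂ : ℝ) - lo₂))
    (hT' : T' ≤ 2 * (lo₁ : ℝ) + ((hi₁ : ℝ) - lo₁) * ((γ - x ^ 2) / (1 - x)) + (2 * (lo₂ : ℝ) + ((hi₂ : ℝ) - lo₂) * g)) :
    DECAtT x T' j' M (fun h => (1 - γ) * (1 - g) * (if h = lo₁ + lo₂ then (1 : ℝ) else 0)
      + γ * (1 - g) * (if h = hi₁ + lo₂ then (1 : ℝ) else 0)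
      + (1 - γ) * g * (if h = lo₁ + hi₂ then (1 : ℝ) else 0)
      + γ * g * (if h = hi₁ + hi₂ then (1 : ℝ) else 0)) := by
  classical
  obtain ⟨A, hA⟩ : ∃ A, hi₁ = lo₁ + A := ⟨hi₁ - lo₁, by omega⟩
  obtain ⟨B, hB⟩ : ∃ B, hi₂ = lo₂ + B := ⟨hi₂ - lo₂, by omega⟩
  have e1 : ((hi₁ : ℝ) - lo₁) = A := by rw [hA]; push_cast; ring
  have e2 : ((hi₂ : ℝ) - lo₂) = B := by rw [hB]; push_cast; ring
  rw [e1, e2] at hT' hcA hcB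
  have hmain := twoBlobShift_topFlipped_lightHeavy_decAtT x γ g T' (lo₁ + lo₂) A B j' M hx0 hx1 hxγ hγx hxg hg1 (by omega) (by omega)
    (by omega) (by omega) (by omega) (by omega) (by omega) hcA hcB (by push_cast; linarith)
  have e : (fun h => if lo₁ + lo₂ ≤ h then LAW2[A, γ, B, g, h - (lo₁ + lo₂)] else 0)
      = fun h => (1 - γ) * (1 - g) * (if h = lo₁ + lo₂ then (1 : ℝ) else 0)
          + γ * (1 - g) * (if h = hi₁ + lo₂ then (1 : ℝ) else 0)
          + (1 - γ) * g * (if h = lo₁ + hi₂ then (1 : ℝ) else 0)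
          + γ * g * (if h = hi₁ + hi₂ then (1 : ℝ) else 0) := by
    funext h
    by_cases hs : lo₁ + lo₂ ≤ h
    · rw [if_pos hs]
      have e0 : (h - (lo₁ + lo₂) = 0) ↔ (h = lo₁ + lo₂) := by omega
      have eA : (h - (lo₁ + lo₂) = A) ↔ (h = hi₁ + lo₂) := by omega
      have eB : (h - (lo₁ + lo₂) = B) ↔ (h = lo₁ + hi₂) := by omega
      have eAB : (h - (lo₁ + lo₂) = A + B) ↔ (h = hi₁ + hi₂) := by omega
      simp only [e0, eA, eB, eAB]
    · rw [if_neg hs, if_neg (by omega), if_neg (by omega), if_neg (by omega), if_neg (by omega)]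
      ring
  rw [e] at hmain
  exact hmain

/-- **THE TOP-FLIPPED LIGHTHEAVY PIECE in the `SH`-mixture form of `lconv_TP`**: `(1−g)·shift_{lo₂}{lo₁, hi₁; γ} + g·shift_{hi₂}{lo₁, hi₁; γ}`. [this work] -/
theorem shift_lightHeavyPairs_decAtT (x T' γ g : ℝ) (j' M lo₁ hi₁ lo₂ hi₂ : ℕ) (hx0 : 0 < x) (hx1 : x < 1)
    (hxγ : x ^ 2 < γ) (hγx : γ < x) (hxg : x ≤ g) (hg1 : g ≤ 1) (h₁ : lo₁ < hi₁) (h₂ : lo₂ < hi₂) (hasp : hi₁ - lo₁ ≤ 4 * (hi₂ - lo₂))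
    (hM : hi₁ + hi₂ ≤ M) (hj1 : hi₁ + lo₂ ≤ j') (hj2 : lo₁ + hi₂ ≤ j') (hj : j' + 1 ≤ hi₁ + hi₂)
    (hcA : ((hi₁ : ℝ) - lo₁) * ((γ - x ^ 2) / (1 - x)) + ((hi₂ : ℝ) - lo₂) * g ≤ 2 * ((hi₁ : ℝ) - lo₁))
    (hcB : ((hi₁ : ℝ) - lo₁) * ((γ - x ^ 2) / (1 - x)) + ((hi₂ : ℝ) - lo₂) * g ≤ 2 * ((hi₂ : ℝ) - lo₂))
    (hT' : T' ≤ 2 * (lo₁ : ℝ) + ((hi₁ : ℝ) - lo₁) * ((γ - x ^ 2) / (1 - x)) + (2 * (lo₂ : ℝ) + ((hi₂ : ℝ) - lo₂) * g)) :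
    DECAtT x T' j' M
      (fun h => (1 - g) * SH[(fun t => TP[lo₁, hi₁, γ, t]), lo₂, h] + g * SH[(fun t => TP[lo₁, hi₁, γ, t]), hi₂, h]) := by
  have e : (fun h => (1 - g) * SH[(fun t => TP[lo₁, hi₁, γ, t]), lo₂, h] + g * SH[(fun t => TP[lo₁, hi₁, γ, t]), hi₂, h])
      = fun h => (1 - γ) * (1 - g) * (if h = lo₁ + lo₂ then (1 : ℝ) else 0)
          + γ * (1 - g) * (if h = hi₁ + lo₂ then (1 : ℝ) else 0)
          + (1 - γ) * g * (if h = lo₁ + hi₂ then (1 : ℝ) else 0)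
          + γ * g * (if h = hi₁ + hi₂ then (1 : ℝ) else 0) :=
    funext fun h => shift_TP_pair_eq γ g lo₁ hi₁ lo₂ hi₂ h h₂.le
  rw [e]
  exact lightHeavyPairPiece_decAtT x T' γ g j' M lo₁ hi₁ lo₂ hi₂ hx0 hx1 hxγ hγx hxg hg1 h₁ h₂ hasp hM hj1 hj2 hj hcA hcB hT'

/-- **THE TOP-FLIPPED LIGHTHEAVY PIECE as a convolution of two cells** (census-2 g53's `LawDec.lconv`): for cells `{lo₁, hi₁; γ}` on `{0..M₁}`
and `{lo₂, hi₂; g}` on `{0..M₂}`. [this work] -/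
theorem lconv_lightHeavyPairs_decAtT (x T' γ g : ℝ) (j' M₁ M₂ lo₁ hi₁ lo₂ hi₂ : ℕ) (hx0 : 0 < x) (hx1 : x < 1)
    (hxγ : x ^ 2 < γ) (hγx : γ < x) (hxg : x ≤ g) (hg1 : g ≤ 1) (h₁ : lo₁ < hi₁) (hM₁ : hi₁ ≤ M₁) (h₂ : lo₂ < hi₂) (hM₂ : hi₂ ≤ M₂) (hasp : hi₁ - lo₁ ≤ 4 * (hi₂ - lo₂))
    (hj1 : hi₁ + lo₂ ≤ j') (hj2 : lo₁ + hi₂ ≤ j') (hj : j' + 1 ≤ hi₁ + hi₂)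
    (hcA : ((hi₁ : ℝ) - lo₁) * ((γ - x ^ 2) / (1 - x)) + ((hi₂ : ℝ) - lo₂) * g ≤ 2 * ((hi₁ : ℝ) - lo₁))
    (hcB : ((hi₁ : ℝ) - lo₁) * ((γ - x ^ 2) / (1 - x)) + ((hi₂ : ℝ) - lo₂) * g ≤ 2 * ((hi₂ : ℝ) - lo₂))
    (hT' : T' ≤ 2 * (lo₁ : ℝ) + ((hi₁ : ℝ) - lo₁) * ((γ - x ^ 2) / (1 - x)) + (2 * (lo₂ : ℝ) + ((hi₂ : ℝ) - lo₂) * g)) :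
    DECAtT x T' j' (M₁ + M₂) (lconv M₁ M₂ (fun t => TP[lo₁, hi₁, γ, t]) (fun t => TP[lo₂, hi₂, g, t])) := by
  have e : lconv M₁ M₂ (fun t => TP[lo₁, hi₁, γ, t]) (fun t => TP[lo₂, hi₂, g, t])
      = fun h => (1 - g) * SH[(fun t => TP[lo₁, hi₁, γ, t]), lo₂, h] + g * SH[(fun t => TP[lo₁, hi₁, γ, t]), hi₂, h] :=
    funext fun h => lconv_TP M₁ M₂ lo₂ hi₂ (fun t => TP[lo₁, hi₁, γ, t]) g
      (fun t ht => TP_eq_zero_of_top_lt lo₁ hi₁ M₁ γ h₁.le hM₁ t ht) (h₂.le.trans hM₂) hM₂ h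
  rw [e]
  exact shift_lightHeavyPairs_decAtT x T' γ g j' (M₁ + M₂) lo₁ hi₁ lo₂ hi₂ hx0 hx1 hxγ hγx hxg hg1 h₁ h₂ hasp (by omega) hj1 hj2 hj hcA hcB hT'

end LawDec

end Quant

end Summit.CriticalPhenomena.PercolationContinuityZ3.Theorems
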